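import Mathlib.NumberTheory.NumberField.Units.Regulator
import Mathlib.MeasureTheory.Group.GeometryOfNumbers
import Literature.NumberTheory.NumberFields.UnitHeightGap
import HarnessLib

/-!
# A lower bound for the regulator of a number field, uniform in the degree

Topic `Literature/NumberTheory/NumberFields`, namespace `Literature.NumberTheory.NumberFields`.
Everything here is PROVED (theorems only, no definitions).

The regulator of a number field is bounded below by a positive constant depending only on its
degree: `exists_regulator_ge_of_finrank_le`.  The sharp form `R_K > 0.2052…` is Friedman's theorem
(after Remak, Pohst, Zimmert); what is proved here is the crude but fully effective bound obtained
from

* Minkowski's convex body theorem (Mathlib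
  `MeasureTheory.exists_ne_zero_mem_lattice_of_measure_mul_two_pow_lt_measure`) applied to Mathlib's
  unit lattice `NumberField.Units.unitLattice K` (whose covolume IS the regulator,
  `NumberField.Units.regulator`) and a sup-norm box: if every unit that is not a root of unity has
  `‖logEmbedding u‖ ≥ t`, then `R_K ≥ t ^ rank` (`pow_rank_le_regulator_of_le_norm_logEmbedding`,
  i.e. `R_K ≥ λ₁^r`, `λ₁` the first minimum of the log-unit lattice);
* the Kronecker-type height gap `‖logEmbedding u‖ > g(n)` of `UnitHeightGap.lean`.

## References
* E. Friedman, *Analytic formulas for the regulator of a number field*, Invent. Math. 98 (1989)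
  599–622 (the sharp bound; we prove a weaker effective one). [Friedman1989]
* R. Remak, *Über Grössenbeziehungen zwischen Diskriminante und Regulator eines algebraischen
  Zahlkörpers*, Compositio Math. 10 (1952) 245–308; R. Zimmert, Invent. Math. 62 (1981) 367–380 — context.
* Mathlib, `Mathlib/NumberTheory/NumberField/Units/Regulator.lean`, `…/GeometryOfNumbers.lean`.
-/

open Module NumberField NumberField.InfinitePlace NumberField.Units
  NumberField.Units.dirichletUnitTheorem MeasureTheory ZSpan

namespace Literature.NumberTheory.NumberFields

variable (K : Type*) [Field K] [NumberField K]

open scoped Classical in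
/-- **Minkowski on the log-unit lattice: `R_K ≥ λ₁^{rank}`.**  If every unit of `K` that is not a
root of unity has `‖logEmbedding K u‖ ≥ t > 0` (sup norm on Mathlib's log space), then
`t ^ rank K ≤ regulator K`.  (The regulator is the covolume of the unit lattice; a sup-norm ball of
radius `t` has volume `(2t)^{rank}`; Minkowski's convex body theorem.) [folklore] -/
theorem pow_rank_le_regulator_of_le_norm_logEmbedding {t : ℝ} (ht : 0 < t)
    (h : ∀ u : (𝓞 K)ˣ, u ∉ torsion K → t ≤ ‖logEmbedding K (Additive.ofMul u)‖) :
    t ^ rank K ≤ regulator K := by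
  by_contra! hlt
  let b : Basis (Fin (rank K)) ℝ (logSpace K) := (basisUnitLattice K).ofZLatticeBasis ℝ (unitLattice K)
  have hspan : Submodule.span ℤ (Set.range b) = unitLattice K := (basisUnitLattice K).ofZLatticeBasis_span ℝ
  have h_fund := ZSpan.isAddFundamentalDomain' b volume
  have : Countable (Submodule.span ℤ (Set.range b)).toAddSubgroup := by
    change Countable (Submodule.span ℤ (Set.range b))
    infer_instance
  -- the volume of the fundamental domain is the regulator
  have hcovol : volume.real (fundamentalDomain b) = regulator K := by
    rw [regulator]
    exact (ZLattice.covolume_eq_measure_fundamentalDomain (unitLattice K) volume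
      (ZLattice.isAddFundamentalDomain (basisUnitLattice K) volume)).symm
  have hvolF : volume (fundamentalDomain b) = ENNReal.ofReal (regulator K) := by
    rw [← hcovol, measureReal_def, ENNReal.ofReal_toReal]
    exact ((fundamentalDomain_isBounded b).measure_lt_top).ne
  -- the sup-norm ball of radius `t`
  have hfin : finrank ℝ (logSpace K) = rank K := Units.finrank_eq_rank K
  have hcard : Fintype.card {w : InfinitePlace K // w ≠ w₀} = rank K := by
    rw [← finrank_fintype_fun_eq_card (R := ℝ)]
    exact hfin
  have hvolB : volume (Metric.ball (0 : logSpace K) t) = ENNReal.ofReal ((2 * t) ^ rank K) := by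
    rw [Real.volume_pi_ball 0 ht, hcard]
  have hcond : volume (fundamentalDomain b) * 2 ^ finrank ℝ (logSpace K) <
      volume (Metric.ball (0 : logSpace K) t) := by
    rw [hvolF, hvolB, hfin]
    have h2 : ENNReal.ofReal (regulator K) * 2 ^ rank K =
        ENNReal.ofReal (regulator K * 2 ^ rank K) := by
      rw [ENNReal.ofReal_mul (regulator_pos K).le, ENNReal.ofReal_pow (by norm_num),
        ENNReal.ofReal_ofNat]
    rw [h2, ENNReal.ofReal_lt_ofReal_iff (by positivity)]
    calc regulator K * 2 ^ rank K < t ^ rank K * 2 ^ rank K :=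
          mul_lt_mul_of_pos_right hlt (by positivity)
      _ = (2 * t) ^ rank K := by rw [mul_pow, mul_comm]
  obtain ⟨⟨x, hx⟩, h_nz, h_mem⟩ := exists_ne_zero_mem_lattice_of_measure_mul_two_pow_lt_measure
    h_fund (fun y hy => by simpa [mem_ball_zero_iff, norm_neg] using hy) (convex_ball 0 t) hcond
  have hx0 : x ≠ 0 := by
    intro h0
    exact h_nz (Subtype.ext h0)
  rw [Submodule.mem_toAddSubgroup, hspan, unitLattice, Submodule.mem_map] at hx
  obtain ⟨a, -, rfl⟩ := hx
  have hmem : ‖logEmbedding K a‖ < t := by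
    simpa [mem_ball_zero_iff] using h_mem
  have hu : Additive.toMul a ∉ torsion K := by
    intro hu
    apply hx0
    have h0 : logEmbedding K (Additive.ofMul (Additive.toMul a)) = 0 := logEmbedding_eq_zero_iff.mpr hu
    simpa using h0
  have := h (Additive.toMul a) hu
  rw [ofMul_toMul] at this
  exact (not_le.mpr hmem) this

/-- `rank K ≤ [K:ℚ]` (`rank = r₁ + r₂ − 1`). [folklore] -/
theorem rank_le_finrank : rank K ≤ finrank ℚ K :=
  (Nat.sub_le _ _).trans (card_infinitePlace_le_finrank K)

/-- **Uniform lower bound for the regulator.** For every `n` there is `c > 0` with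
`regulator K ≥ c` for every number field `K` of degree `≤ n` (Minkowski + the Kronecker height gap;
the sharp value `0.2052…` is Friedman's). [cite: Friedman1989, Thm. B (weaker effective form)] -/
theorem exists_regulator_ge_of_finrank_le (n : ℕ) :
    ∃ c : ℝ, 0 < c ∧ ∀ (K : Type) [Field K] [NumberField K], finrank ℚ K ≤ n → c ≤ regulator K := by
  obtain ⟨g, hg, hgap⟩ := exists_norm_logEmbedding_gt_of_finrank_le n
  refine ⟨min g 1 ^ n, by positivity, fun K _ _ hK => ?_⟩
  have h1 : min g 1 ^ rank K ≤ regulator K :=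
    pow_rank_le_regulator_of_le_norm_logEmbedding K (lt_min hg one_pos)
      (fun u hu => (min_le_left _ _).trans (hgap K hK u hu).le)
  calc min g 1 ^ n ≤ min g 1 ^ rank K :=
        pow_le_pow_of_le_one (by positivity) (min_le_right _ _) ((rank_le_finrank K).trans hK)
    _ ≤ regulator K := h1

end Literature.NumberTheory.NumberFields
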